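import Summits.QuantumFields.YangMills.Theorems.UnitScaleTiltProp7DbarTwWindow
import HarnessLib

/-!
# Route `UnitScaleTilt`, crux K1 «MinimiserStabilityRegPr» (stmt-QuantumFields-19200), route-R E′ (A′)-on-Σ, P-A2 (β) — **(c3)ᶜ hP-FREE, FILE 1∕2: PRINT's COMB TOWER AT ONE LEVEL —
# the (161)∕(163)∕(92) rows and the `¼`-window of `\overline{U₁U₀}ʲ`'s block loops FROM THAT LEVEL's UNITARITY, for a skew, sup-small perturbation `U₁ = e^{B}` (no (1.141))**

Cell `ym3-torus` (HUMAN RULING D-0037: YM₃ on the torus is ladder rung R3 — not d = 4, not a mass gap, not Clay), width seat `ym3-torus-px17` (gen 4); ★★OWNER RULING №19 «F3″-COMB (c1)(c2)(c4)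
under `hMcomb`» (pen ★routeR-w6 g8: F1 ✓`Prop7CombAccFrameStep`, F2, F3) — this pair of files is the (c3) SUP∕UNITARITY input of that plan (px17 g4 05:29Z offer + 05:37Z located point).
`--supports stmt-QuantumFields-19200 --as helper`; THEOREMS ONLY (0 `def`, 0 `sorry`); count-neutral.  Nothing of `hMcomb`, (β), `hPA2`, `hcoS`, E′, EX, the crux, d = 4 or the gap is claimed.

THE LOCATED POINT.  lit-balaban ✓`B8Prop7AdmittedFamily` proves the `G`-valuedness of the comb-tower objects (`dbavgCovIter_vcov_mem_unitaryUnits`, `avgIter_mul_mem_unitaryUnits`) and the sup rows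
`norm_tildIter_sub_one_le` (`130dLʲb`), `norm_dbavgCovIter_sub_one_le` (`2Lʲb`) under print's Prop.-7 hypotheses INCLUDING `hP : pdev (e^{B}U₀) < αP·(Lᵏ)⁻²` = [Balaban1985RegularSpaces] (1.141)
«|(U₁U₀)(∂p) − 1| < (α₀ + 3α₂)L^{−2j}» — plaquette-smallness of the PERTURBED field at scale `η²`.  At the route's (β) door the perturbation is only SUP-small (`‖A(b)‖ ≤ e·η`, `A` skew; no
gradient clause), so `pdev(e^{A}U₀♯) ≍ eη ≫ η²`: `hP` is unavailable there.  lit's ONLY use of `hP` is the `G`-valuedness of the PLAIN average `\overline{U₁U₀}^{j+1}` (via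
`B7Prop2Explicit.avgIter_mem`, which needs (52) for the field being averaged).  This file supplies the replacement: the block loops `V(Γ_{c,x})V(c)⁻¹` of the level-`j` field
`V = \overline{U₁U₀}ʲ = Ũ₁ʲ·Ū₀ʲ` (lit ✓`tildIter_mul`) are in the `¼`-window of the logarithm (so lit ✓`bavg_mem_unitaryUnits` applies) as soon as `U̿₁ʲ` and `v_j` are unitary — because `Ū₀ʲ`'s
loops are within `1∕64` (lit ✓`norm_Wcx_sub_one_le` on ✓`B7Eq123General.level_data`) and `‖(Ũ₁ʲŪ₀ʲ)(Γ) − Ū₀ʲ(Γ)‖ ≤ (1 + 130dLʲb)^{|Γ|} − 1` (§1).  FILE 2 (`Prop7CombTowerUnitaryOfSkew`) runs the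
induction on `j` and reads the T³ member.  Price: one sup window `4096·d(d+1)·Lᵏb ≤ 1` (print: «for α₁ sufficiently small»; at the member `Lᵏb = e`, implied by `10⁶L²e ≤ 1`).

THE PRINT.  [Balaban1985Averaging] p. 18 «values in a Lie subgroup G of a unitary group U(N)», (22)–(24) p. 21, (42)–(43) pp. 23–24, p. 25, (52)–(54) p. 26, (69) p. 29, (92) p. 31, (97) p. 32,
(161)–(163) p. 42, p. 44 «all operations needed to define R̄₀uᵏ are done always in a case where proper expressions are small»; [Balaban1985RegularSpaces] Prop. 7 (1.139)–(1.145) p. 100.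

WHAT IS PROVED (ns `…Theorems.Prop7CombTowerLevelUnitarity`; any C⋆-algebra `𝔸`, lit `ℤᵈ` letters).
* §1 `expCfg_mem_unitaryUnits_of_skew`; `norm_stepHol_mul_sub_stepHol_le`, ★`norm_hol_mul_sub_hol_le` (`‖(V₁V₀)(Γ) − V₀(Γ)‖ ≤ (1+δ)^{|Γ|} − 1`), `norm_Wcx_mul_sub_one_le`.
* §2 (hypotheses = lit `B8Prop7AdmittedFamily` §3's MINUS `hBu hαP hαP3 hαP2 hP`, PLUS `hsm2 : 4096·d(d+1)·Lᵏb ≤ 1`): `level_windows`, `norm_hol_avgIter_le_one`, `norm_dbavgCovIter_sub_one_le_of_mem` ((161)),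
  `tildIter_mem_unitaryUnits_of_mem` ((92)), `norm_tildIter_sub_one_le_of_mem` ((163)∘(161): `130dLʲb`), ★★`Wcx_window_of_mem` (the `¼`-window of `\overline{U₁U₀}ʲ`'s block loops, `j < k`).
HONEST SCOPE.  Bookkeeping over lit's certified identities and estimates; constants are this lineage's; no `ℓ²` statement, nothing of (n3)-comb.

References: T. Bałaban, CMP **98** (1985) 17–51 [Balaban1985Averaging]; CMP **99** (1985) 75–102 [Balaban1985RegularSpaces]; CMP **102** (1985) 277–309 [Balaban1985Variational] ((19) p.281).
-/

set_option autoImplicit false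

noncomputable section

open scoped BigOperators Matrix.Norms.L2Operator

namespace Summit.QuantumFields.YangMills.Theorems.Prop7CombTowerLevelUnitarity

open NormedSpace
open Literature.MathematicalPhysics.QuantumFieldTheory.Balaban1983to89
open B7Prop1Explicit renaming Site → LSite
open B7Prop1Explicit (Letter hol hol_cons hol_nil hol_append stepHol e disp gammaWord seg treeWord boxVec l1 l1_boxVec_le length_gammaWord length_seg Wcx Wcx_eq_hol_loop U1 mem_U1
  expUnit val_expUnit plaqWord norm_inv_sub_one_le norm_units_conj_sub_one_le bavg)
open B7Prop2Explicit (avgIter avgIter_zero avgIter_succ rescale pdev le_pdev C0 c2' unitaryUnits mem_unitaryUnits unitaryUnits_le_U1 avgClosed_unitaryUnits bavg_mem_unitaryUnits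
  norm_Wcx_sub_one_le hol_mem_of)
open B7Prop3Flat (expCfg c3)
open B7Eq92Concrete (Rc Rc_apply mgauge mgauge_apply tHol wframe tild tild_apply dbavgCov dbavgCov_apply tildIter tildIter_mul tildIter_eq_mgauge dbavgCovIter dbavgCovIter_zero
  dbavgCovIter_succ vcov vcov_zero vcov_succ)
open B7Eq162General (level_facts)
open B7Eq123General (level_data)
open B7Prop8PrintedConstants (norm_exp_sub_one_le_of_mem_unitary Rc_mem_unitaryUnits)
open B8Prop7AdmittedFamily (wframe_mem_unitaryUnits tild_eq_of_mgauge avgIter_mem_unitaryUnits twist_le_quarter norm_vcov_sub_one_le)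
open B8Lemma1NonAbelian (norm_units_mul_sub_one_le)

variable {d : ℕ}

/-! ## §1 Generic letters: `e^{B}` is unitary for skew `B`; the holonomy of a product field along a word -/

section Generic

variable {𝔸 : Type*} [CStarAlgebra 𝔸]

/-- **`e^{B}` IS UNITARY-VALUED FOR A BONDWISE SKEW-ADJOINT EXPONENT** (print's `U₁ = e^{iηA}`, `A` in the Lie algebra of `G ⊂ U(N)`; Mathlib `NormedSpace.exp_mem_unitary_of_mem_skewAdjoint`).
[cite: Balaban1985Averaging, (22)-(24) p.21; Balaban1985RegularSpaces, (1.140) p.100] -/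
theorem expCfg_mem_unitaryUnits_of_skew {B : LSite d → Fin d → 𝔸} (hBs : ∀ x κ, star (B x κ) = -B x κ) (x : LSite d) (κ : Fin d) :
    expCfg B x κ ∈ unitaryUnits 𝔸 := by
  letI : NormedAlgebra ℚ 𝔸 := NormedAlgebra.restrictScalars ℚ ℂ 𝔸
  rw [mem_unitaryUnits]
  show ((expUnit (B x κ) : 𝔸ˣ) : 𝔸) ∈ unitary 𝔸
  rw [val_expUnit]
  exact NormedSpace.exp_mem_unitary_of_mem_skewAdjoint ((skewAdjoint.mem_iff).2 (hBs x κ))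

variable [Nontrivial 𝔸]

/-- One letter of a word: for `V₀` bi-contractive and `V₁`, `V₁⁻¹` bondwise within `δ` of `1`, the step transports of `V₁V₀` and `V₀` differ by at most `δ` (forward letter:
`V₁V₀ − V₀ = (V₁ − 1)V₀`; backward letter: `V₀⁻¹V₁⁻¹ − V₀⁻¹ = V₀⁻¹(V₁⁻¹ − 1)`). [cite: Balaban1985Averaging, (9) p.18, (19) p.21] -/
theorem norm_stepHol_mul_sub_stepHol_le {V₀ V₁ : LSite d → Fin d → 𝔸ˣ} (hV₀ : ∀ x κ, V₀ x κ ∈ U1 𝔸) {δ : ℝ}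
    (hV₁ : ∀ x κ, ‖(V₁ x κ : 𝔸) - 1‖ ≤ δ ∧ ‖(((V₁ x κ)⁻¹ : 𝔸ˣ) : 𝔸) - 1‖ ≤ δ) (x : LSite d) (l : Letter d) :
    ‖((stepHol (V₁ * V₀) x l : 𝔸ˣ) : 𝔸) - ((stepHol V₀ x l : 𝔸ˣ) : 𝔸)‖ ≤ δ := by
  rcases l with ⟨μ, _ | _⟩
  · -- backward letter
    simp only [stepHol, Bool.false_eq_true, ↓reduceIte, Pi.mul_apply, mul_inv_rev, Units.val_mul]
    set y := x + Letter.vec ((μ, false) : Letter d)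
    have h1 : (((V₀ y μ)⁻¹ : 𝔸ˣ) : 𝔸) * (((V₁ y μ)⁻¹ : 𝔸ˣ) : 𝔸) - (((V₀ y μ)⁻¹ : 𝔸ˣ) : 𝔸)
        = (((V₀ y μ)⁻¹ : 𝔸ˣ) : 𝔸) * ((((V₁ y μ)⁻¹ : 𝔸ˣ) : 𝔸) - 1) := by rw [mul_sub, mul_one]
    rw [h1]
    exact (norm_mul_le _ _).trans (by
      have := (hV₀ y μ).2
      have := (hV₁ y μ).2
      nlinarith [norm_nonneg ((((V₁ y μ)⁻¹ : 𝔸ˣ) : 𝔸) - 1), norm_nonneg (((V₀ y μ)⁻¹ : 𝔸ˣ) : 𝔸)])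
  · -- forward letter
    simp only [stepHol, ↓reduceIte, Pi.mul_apply, Units.val_mul]
    have h1 : (V₁ x μ : 𝔸) * (V₀ x μ : 𝔸) - (V₀ x μ : 𝔸) = ((V₁ x μ : 𝔸) - 1) * (V₀ x μ : 𝔸) := by rw [sub_mul, one_mul]
    rw [h1]
    exact (norm_mul_le _ _).trans (by
      have := (hV₀ x μ).1
      have := (hV₁ x μ).1
      nlinarith [norm_nonneg ((V₁ x μ : 𝔸) - 1), norm_nonneg (V₀ x μ : 𝔸)])

/-- ★ **THE HOLONOMY OF A PRODUCT FIELD ALONG A WORD**: for `V₀` bi-contractive and `V₁`, `V₁⁻¹` bondwise within `δ` of `1`, `‖(V₁V₀)(Γ) − V₀(Γ)‖ ≤ (1 + δ)^{|Γ|} − 1` for every word `Γ`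
(induction on the word: `s₁H₁ − s₀H₀ = (s₁ − s₀)H₁ + s₀(H₁ − H₀)`). [cite: Balaban1985Averaging, (9) p.18, (19) p.21, (47) p.25] -/
theorem norm_hol_mul_sub_hol_le {V₀ V₁ : LSite d → Fin d → 𝔸ˣ} (hV₀ : ∀ x κ, V₀ x κ ∈ U1 𝔸) {δ : ℝ} (hδ : 0 ≤ δ)
    (hV₁ : ∀ x κ, ‖(V₁ x κ : 𝔸) - 1‖ ≤ δ ∧ ‖(((V₁ x κ)⁻¹ : 𝔸ˣ) : 𝔸) - 1‖ ≤ δ) :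
    ∀ (x : LSite d) (w : List (Letter d)), ‖((hol (V₁ * V₀) x w : 𝔸ˣ) : 𝔸) - ((hol V₀ x w : 𝔸ˣ) : 𝔸)‖ ≤ (1 + δ) ^ w.length - 1
  | x, [] => by simp
  | x, l :: w => by
    have ih := norm_hol_mul_sub_hol_le hV₀ hδ hV₁ (x + l.vec) w
    rw [hol_cons, hol_cons, Units.val_mul, Units.val_mul, List.length_cons, pow_succ]
    set s₁ : 𝔸 := ((stepHol (V₁ * V₀) x l : 𝔸ˣ) : 𝔸)
    set s₀ : 𝔸 := ((stepHol V₀ x l : 𝔸ˣ) : 𝔸)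
    set H₁ : 𝔸 := ((hol (V₁ * V₀) (x + l.vec) w : 𝔸ˣ) : 𝔸)
    set H₀ : 𝔸 := ((hol V₀ (x + l.vec) w : 𝔸ˣ) : 𝔸)
    have hs : ‖s₁ - s₀‖ ≤ δ := norm_stepHol_mul_sub_stepHol_le hV₀ hV₁ x l
    have hs₀ : ‖s₀‖ ≤ 1 := (B7Prop2Explicit.stepHol_mem_of hV₀ x l).1
    have hH₀ : ‖H₀‖ ≤ 1 := (hol_mem_of hV₀ (x + l.vec) w).1
    have hp : (1 : ℝ) ≤ (1 + δ) ^ w.length := one_le_pow₀ (by linarith)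
    have hH₁ : ‖H₁‖ ≤ (1 + δ) ^ w.length := by
      have : H₁ = H₀ + (H₁ - H₀) := by abel
      rw [this]
      exact (norm_add_le _ _).trans (by linarith)
    have e1 : s₁ * H₁ - s₀ * H₀ = (s₁ - s₀) * H₁ + s₀ * (H₁ - H₀) := by noncomm_ring
    rw [e1]
    calc ‖(s₁ - s₀) * H₁ + s₀ * (H₁ - H₀)‖ ≤ ‖s₁ - s₀‖ * ‖H₁‖ + ‖s₀‖ * ‖H₁ - H₀‖ :=
          (norm_add_le _ _).trans (add_le_add (norm_mul_le _ _) (norm_mul_le _ _))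
      _ ≤ δ * (1 + δ) ^ w.length + 1 * ((1 + δ) ^ w.length - 1) :=
          add_le_add (mul_le_mul hs hH₁ (norm_nonneg _) hδ) (mul_le_mul hs₀ ih (norm_nonneg _) zero_le_one)
      _ = (1 + δ) ^ w.length * (1 + δ) - 1 := by ring

/-- **THE BLOCK LOOP OF A PRODUCT FIELD**: `‖(V₁V₀)(Γ_{c,x})(V₁V₀)(c)⁻¹ − 1‖ ≤ ‖V₀(Γ_{c,x})V₀(c)⁻¹ − 1‖ + ((1+δ)^{2|x−c₋|₁+2L} − 1)` — the argument of the logarithm in print's average (42) of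
the product field, against that of the background (lit `Wcx_eq_hol_loop`: the loop `Γ_{c,x} ∪ (−Γ_c)` has `2|x − c₋|₁ + 2L` letters). [cite: Balaban1985Averaging, (42) p.23, p.25] -/
theorem norm_Wcx_mul_sub_one_le (L : ℕ) {V₀ V₁ : LSite d → Fin d → 𝔸ˣ} (hV₀ : ∀ x κ, V₀ x κ ∈ U1 𝔸) {δ : ℝ} (hδ : 0 ≤ δ)
    (hV₁ : ∀ x κ, ‖(V₁ x κ : 𝔸) - 1‖ ≤ δ ∧ ‖(((V₁ x κ)⁻¹ : 𝔸ˣ) : 𝔸) - 1‖ ≤ δ) (q : LSite d) (κ : Fin d) (r : LSite d) :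
    ‖(Wcx L (V₁ * V₀) q κ r : 𝔸) - 1‖ ≤ ‖(Wcx L V₀ q κ r : 𝔸) - 1‖ + ((1 + δ) ^ (2 * l1 r + L + L) - 1) := by
  rw [Wcx_eq_hol_loop, Wcx_eq_hol_loop]
  have h := norm_hol_mul_sub_hol_le hV₀ hδ hV₁ q (gammaWord L κ r ++ seg κ (-(L : ℤ)))
  have hlen : (gammaWord L κ r ++ seg κ (-(L : ℤ))).length = 2 * l1 r + L + L := by
    rw [List.length_append, length_gammaWord, length_seg]; simp
  rw [hlen] at h
  have e1 : ((hol (V₁ * V₀) q (gammaWord L κ r ++ seg κ (-(L : ℤ))) : 𝔸ˣ) : 𝔸) - 1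
      = (((hol V₀ q (gammaWord L κ r ++ seg κ (-(L : ℤ))) : 𝔸ˣ) : 𝔸) - 1)
        + (((hol (V₁ * V₀) q (gammaWord L κ r ++ seg κ (-(L : ℤ))) : 𝔸ˣ) : 𝔸) - ((hol V₀ q (gammaWord L κ r ++ seg κ (-(L : ℤ))) : 𝔸ˣ) : 𝔸)) := by abel
  rw [e1]
  exact (norm_add_le _ _).trans (add_le_add le_rfl h)

end Generic

/-! ## §2 The comb tower of a skew, sup-small perturbation at a regular background is unitary-valued — WITHOUT (1.141) -/

section Tower

variable {𝔸 : Type*} [CStarAlgebra 𝔸] [Nontrivial 𝔸]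

open B7Prop4GeneralLevels (logCovIter)

variable {L k : ℕ} {U₀ : LSite d → Fin d → 𝔸ˣ} {B : LSite d → Fin d → 𝔸} {α₀ b : ℝ}
  (hd : 1 ≤ d) (hL : 2 ≤ L) (hU₀ : ∀ x κ, U₀ x κ ∈ unitaryUnits 𝔸) (hBs : ∀ x κ, star (B x κ) = -B x κ)
  (hα : 0 < α₀) (hα3 : C0 d * α₀ ≤ 1 / 3) (hα4 : 4 * α₀ ≤ c2' d L) (h52 : pdev U₀ < α₀ * (((L : ℝ) ^ k)⁻¹) ^ 2)
  (hb : 0 ≤ b) (hB : ∀ x κ, ‖B x κ‖ ≤ b)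
  (hsmall : Real.exp (4 * (800 * ((d : ℝ) + 1) ^ 2 * ((d : ℝ) + 4)) * α₀)
    * (1 + 8 * (131072 * ((d : ℝ) + 1) ^ 2) * ((L : ℝ) ^ k * b)) ≤ 2)
  (hc₃ : 2 * ((L : ℝ) ^ k * b) ≤ c3 d L)
  (hsm2 : 4096 * (d : ℝ) * ((d : ℝ) + 1) * ((L : ℝ) ^ k * b) ≤ 1)

omit [Nontrivial 𝔸] in
/-- `|abc − 1| ≤ |a − 1| + |b − 1| + |c − 1|` for `a, b` bi-contractive (print's tacit bookkeeping behind (163)). [folklore] -/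
private theorem norm_mul₃_units_sub_one_le [NormOneClass 𝔸] {a b' c : 𝔸ˣ} (ha : a ∈ U1 𝔸) (hb' : b' ∈ U1 𝔸) :
    ‖((a * b' * c : 𝔸ˣ) : 𝔸) - 1‖ ≤ ‖(a : 𝔸) - 1‖ + ‖(b' : 𝔸) - 1‖ + ‖(c : 𝔸) - 1‖ :=
  (norm_units_mul_sub_one_le ((U1 𝔸).mul_mem ha hb')).trans (by linarith [norm_units_mul_sub_one_le (q := b') ha])

include hd hL hb hsm2 in
/-- Level arithmetic from the one sup window `4096·d(d+1)·Lᵏb ≤ 1` (`d ≥ 1`, `L ≥ 2`): the lit window `2048·d·Lᵏb ≤ 1`, `Lʲb ≤ Lᵏb`, `2Lʲb ≤ 1∕5` (`j ≤ k`) and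
`260·d(d+1)·L^{j+1}b ≤ 1∕15` (`j < k`) (print: «for α₁ sufficiently small»). [cite: Balaban1985Averaging, (162)-(163) p.42] -/
theorem level_windows :
    2048 * (d : ℝ) * ((L : ℝ) ^ k * b) ≤ 1 ∧ (∀ j ≤ k, (L : ℝ) ^ j * b ≤ (L : ℝ) ^ k * b) ∧ (∀ j ≤ k, 2 * ((L : ℝ) ^ j * b) ≤ 1 / 5) ∧
      ∀ j < k, 260 * (d : ℝ) * ((d : ℝ) + 1) * ((L : ℝ) ^ (j + 1) * b) ≤ 1 / 15 := by
  have hL1 : (1 : ℝ) ≤ L := by exact_mod_cast le_trans (by norm_num) hL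
  have hd1 : (1 : ℝ) ≤ d := by exact_mod_cast hd
  set x : ℝ := (L : ℝ) ^ k * b with hx
  have hx0 : 0 ≤ x := by positivity
  have hmono : ∀ j ≤ k, (L : ℝ) ^ j * b ≤ x := fun j hj =>
    mul_le_mul_of_nonneg_right (pow_le_pow_right₀ hL1 hj) hb
  have hdd : 2 ≤ (d : ℝ) * ((d : ℝ) + 1) := by nlinarith
  have hdd0 : 0 ≤ (d : ℝ) * ((d : ℝ) + 1) := by positivity
  have hx1 : 8192 * x ≤ 1 := by nlinarith [mul_le_mul_of_nonneg_right hdd hx0]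
  have h1 : 2048 * (d : ℝ) * x ≤ 1 := by nlinarith [mul_nonneg (mul_nonneg (by positivity : (0:ℝ) ≤ d) (by positivity : (0:ℝ) ≤ d)) hx0]
  refine ⟨h1, hmono, fun j hj => ?_, fun j hj => ?_⟩
  · have := hmono j hj
    linarith
  · have h2 : 260 * (d : ℝ) * ((d : ℝ) + 1) * ((L : ℝ) ^ (j + 1) * b) ≤ 260 * (d : ℝ) * ((d : ℝ) + 1) * x := by
      have := mul_le_mul_of_nonneg_left (hmono (j + 1) hj) hdd0
      nlinarith
    nlinarith

include hL hU₀ hα hα3 hα4 h52 in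
/-- The background tree transports `Ū₀ʲ(Γ)` and their inverses have norm `≤ 1` at every level `j ≤ k` (lit ✓`avgIter_mem_unitaryUnits`; F1's `hhol` letter).
[cite: Balaban1985Averaging, (52)-(54) p.26, (19) p.21] -/
theorem norm_hol_avgIter_le_one {j : ℕ} (hj : j ≤ k) (y : LSite d) (w : List (Letter d)) :
    ‖((hol (avgIter L U₀ j) y w : 𝔸ˣ) : 𝔸)‖ ≤ 1 ∧ ‖(((hol (avgIter L U₀ j) y w)⁻¹ : 𝔸ˣ) : 𝔸)‖ ≤ 1 :=
  unitaryUnits_le_U1 (hol_mem_of (avgIter_mem_unitaryUnits hL hU₀ hα hα3 hα4 h52 j hj) y w)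

include hd hL hU₀ hα hα3 hα4 h52 hb hB hsmall hc₃ hsm2 in
/-- **(161) AT ONE LEVEL FROM THAT LEVEL's UNITARITY**: if `U̿₁ʲ` is unitary-valued then `‖U̿₁ʲ(b) − 1‖ ≤ |Q_j| ≤ 2Lʲb` (lit ✓`B7Eq162General.level_facts`: `U̿₁ʲ = e^{Q_j}`, `|Q_j| ≤ 2Lʲb` — hP-free;
`B7Prop8PrintedConstants.norm_exp_sub_one_le_of_mem_unitary`). [cite: Balaban1985Averaging, (161) p.42, (24) p.21; Balaban1985RegularSpaces, (1.143) p.100] -/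
theorem norm_dbavgCovIter_sub_one_le_of_mem {j : ℕ} (hj : j ≤ k) (hWu : ∀ z κ, dbavgCovIter L U₀ (expCfg B) j z κ ∈ unitaryUnits 𝔸) (z : LSite d) (κ : Fin d) :
    ‖((dbavgCovIter L U₀ (expCfg B) j z κ : 𝔸ˣ) : 𝔸) - 1‖ ≤ 2 * ((L : ℝ) ^ j * b) := by
  obtain ⟨-, hW, hQ⟩ := level_facts hL (avgClosed_unitaryUnits d L) hU₀ hα hα3 hα4 h52 hb hB hsmall hc₃ j hj
  have hmem := hWu z κ
  rw [hW] at hmem ⊢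
  have hval : ((expCfg (logCovIter L U₀ B j) z κ : 𝔸ˣ) : 𝔸) = exp (logCovIter L U₀ B j z κ) := rfl
  rw [mem_unitaryUnits, hval] at hmem
  rw [hval]
  have h5 : ‖logCovIter L U₀ B j z κ‖ ≤ 1 / 5 := (hQ z κ).trans ((level_windows hd hL hb hsm2).2.2.1 j hj)
  exact (norm_exp_sub_one_le_of_mem_unitary hmem h5).trans (hQ z κ)

include hL hU₀ hα hα3 hα4 h52 in
/-- **`Ũ₁ʲ` IS UNITARY AT ONE LEVEL FROM THAT LEVEL's UNITARITY of `U̿₁ʲ` and `v_j`**: (92)∕(97) `(Ũ₁ʲ)_b = v_j(b₋)(U̿₁ʲ)_b R̄ʲ_{0,b}v_j(b₊)⁻¹` (lit ✓`tildIter_eq_mgauge`) is a product of unitaries.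
[cite: Balaban1985Averaging, (92) p.31, (97) p.32] -/
theorem tildIter_mem_unitaryUnits_of_mem {j : ℕ} (hj : j ≤ k) (hWu : ∀ z κ, dbavgCovIter L U₀ (expCfg B) j z κ ∈ unitaryUnits 𝔸)
    (hvu : ∀ z, vcov L U₀ (expCfg B) j z ∈ unitaryUnits 𝔸) (z : LSite d) (κ : Fin d) :
    tildIter L U₀ (expCfg B) j z κ ∈ unitaryUnits 𝔸 := by
  have hV₀ := avgIter_mem_unitaryUnits hL hU₀ hα hα3 hα4 h52 j hj
  rw [tildIter_eq_mgauge L U₀ (expCfg B) j, mgauge_apply]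
  exact (unitaryUnits 𝔸).mul_mem ((unitaryUnits 𝔸).mul_mem (hvu z) (hWu z κ)) ((unitaryUnits 𝔸).inv_mem (Rc_mem_unitaryUnits (hV₀ z κ) (hvu _)))

include hd hL hU₀ hα hα3 hα4 h52 hb hB hsmall hc₃ hsm2 in
/-- **`Ũ₁ʲ` IS WITHIN `130dLʲb` OF `1` AT ONE LEVEL FROM THAT LEVEL's UNITARITY** — lit ✓`B8Prop7AdmittedFamily.norm_tildIter_sub_one_le`'s proof verbatim ((97)∕(92) with (163) for the frames
and (161) for `U̿₁ʲ`), its (1.141)-sourced unitarity replaced by the hypotheses `hWu hvu`. [cite: Balaban1985Averaging, (97) p.32, (161)-(163) p.42] -/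
theorem norm_tildIter_sub_one_le_of_mem {j : ℕ} (hj : j ≤ k) (hWu : ∀ z κ, dbavgCovIter L U₀ (expCfg B) j z κ ∈ unitaryUnits 𝔸)
    (hvu : ∀ z, vcov L U₀ (expCfg B) j z ∈ unitaryUnits 𝔸) (z : LSite d) (κ : Fin d) :
    ‖((tildIter L U₀ (expCfg B) j z κ : 𝔸ˣ) : 𝔸) - 1‖ ≤ 130 * (d : ℝ) * ((L : ℝ) ^ j * b) := by
  have hd1 : (1 : ℝ) ≤ d := by exact_mod_cast hd
  have hsm := (level_windows hd hL hb hsm2).1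
  have hV₀ := avgIter_mem_unitaryUnits hL hU₀ hα hα3 hα4 h52 j hj
  rw [tildIter_eq_mgauge L U₀ (expCfg B) j, mgauge_apply]
  have ha : vcov L U₀ (expCfg B) j z ∈ U1 𝔸 := unitaryUnits_le_U1 (hvu z)
  have hb' : dbavgCovIter L U₀ (expCfg B) j z κ ∈ U1 𝔸 := unitaryUnits_le_U1 (hWu z κ)
  have hR : Rc (avgIter L U₀ j z κ) (vcov L U₀ (expCfg B) j (z + e κ)) ∈ U1 𝔸 :=
    unitaryUnits_le_U1 (Rc_mem_unitaryUnits (hV₀ z κ) (hvu _))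
  have h3 := norm_mul₃_units_sub_one_le (c := (Rc (avgIter L U₀ j z κ) (vcov L U₀ (expCfg B) j (z + e κ)))⁻¹) ha hb'
  have hc : ‖(((Rc (avgIter L U₀ j z κ) (vcov L U₀ (expCfg B) j (z + e κ)))⁻¹ : 𝔸ˣ) : 𝔸) - 1‖ ≤ 64 * (d : ℝ) * ((L : ℝ) ^ j * b) := by
    refine (norm_inv_sub_one_le hR).trans ?_
    rw [Rc_apply, Units.val_mul, Units.val_mul]
    exact (norm_units_conj_sub_one_le (unitaryUnits_le_U1 (hV₀ z κ)) _).trans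
      (norm_vcov_sub_one_le hL hU₀ hα hα3 hα4 h52 hb hB hsmall hc₃ hsm hj _).1
  have h1 := (norm_vcov_sub_one_le hL hU₀ hα hα3 hα4 h52 hb hB hsmall hc₃ hsm hj z).1
  have h2 := norm_dbavgCovIter_sub_one_le_of_mem hd hL hU₀ hα hα3 hα4 h52 hb hB hsmall hc₃ hsm2 hj hWu z κ
  have hjb : 0 ≤ (L : ℝ) ^ j * b := by positivity
  nlinarith

include hd hL hU₀ hα hα3 hα4 h52 hb hB hsmall hc₃ hsm2 in
/-- ★★ **THE `¼`-WINDOW OF THE BLOCK LOOPS OF `\overline{U₁U₀}ʲ` FROM LEVEL-`j` UNITARITY** (`j < k`): every argument `V(Γ_{c,x})V(c)⁻¹` of the logarithm in print's average (42) of the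
level-`j` field `V = \overline{U₁U₀}ʲ = Ũ₁ʲ·Ū₀ʲ` (lit ✓`tildIter_mul`) is within `¼` of `1`: the background's loop is within `1∕64` (lit ✓`norm_Wcx_sub_one_le` on ✓`level_data`'s plaquettes
`< 2α₀(Lʲ∕Lᵏ)² ≤ 1∕(1024(d+1)(d+4)L²)`) and the product-field correction is `≤ (1 + 130dLʲb)^{2(d+1)L} − 1 ≤ 2·260d(d+1)L^{j+1}b ≤ 2∕15` (§1 + `4096·d(d+1)Lᵏb ≤ 1`).
[cite: Balaban1985Averaging, (42) p.23, p.25, (52)-(54) p.26, (69) p.29, (161)-(163) p.42] -/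
theorem Wcx_window_of_mem {j : ℕ} (hj : j < k) (hWu : ∀ z κ, dbavgCovIter L U₀ (expCfg B) j z κ ∈ unitaryUnits 𝔸)
    (hvu : ∀ z, vcov L U₀ (expCfg B) j z ∈ unitaryUnits 𝔸) (q : LSite d) (κ : Fin d) (r : Fin d → Fin L) :
    ‖((Wcx L (avgIter L (expCfg B * U₀) j) q κ (boxVec L r) : 𝔸ˣ) : 𝔸) - 1‖ ≤ 1 / 4 := by
  have hL1 : 1 ≤ L := le_trans (by norm_num) hL
  have hLr : (1 : ℝ) ≤ L := by exact_mod_cast hL1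
  have hd0 : (0 : ℝ) ≤ d := Nat.cast_nonneg d
  obtain ⟨hsm, hmono, -, h260⟩ := level_windows hd hL hb hsm2
  -- the background's loop
  obtain ⟨hV, hαj0, hpdev, hαjle⟩ := level_data L hL (avgClosed_unitaryUnits d L) k U₀ hU₀ hα hα3 hα4 h52 j hj.le
  set αj : ℝ := 2 * (α₀ * ((L : ℝ) ^ j * ((L : ℝ) ^ k)⁻¹) ^ 2) with hαj
  have hDpos : 0 < 1024 * ((d : ℝ) + 1) * ((d : ℝ) + 4) * (L : ℝ) ^ 2 := by positivity
  have hsmallj : 512 * (d + 1) * (d + 4) * (L : ℝ) ^ 2 * αj ≤ 1 := by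
    have h1 : 512 * ((d : ℝ) + 1) * ((d : ℝ) + 4) * (L : ℝ) ^ 2 * αj ≤ 512 * ((d : ℝ) + 1) * ((d : ℝ) + 4) * (L : ℝ) ^ 2 * (1 / (1024 * ((d : ℝ) + 1) * ((d : ℝ) + 4) * (L : ℝ) ^ 2)) :=
      mul_le_mul_of_nonneg_left hαjle (by positivity)
    have h2 : 512 * ((d : ℝ) + 1) * ((d : ℝ) + 4) * (L : ℝ) ^ 2 * (1 / (1024 * ((d : ℝ) + 1) * ((d : ℝ) + 4) * (L : ℝ) ^ 2)) = 1 / 2 := by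
      field_simp; ring
    linarith
  have h44 : ∀ (x : LSite d) (κ κ' : Fin d), κ ≠ κ' → ‖((hol (avgIter L U₀ j) x (plaqWord κ κ') : 𝔸ˣ) : 𝔸) - 1‖ ≤ αj :=
    fun x κ κ' _ => (le_pdev hV x κ κ').trans hpdev.le
  have hbg : ‖((Wcx L (avgIter L U₀ j) q κ (boxVec L r) : 𝔸ˣ) : 𝔸) - 1‖ ≤ 1 / 64 := by
    refine (norm_Wcx_sub_one_le L hL1 (avgIter L U₀ j) hV hαj0 hsmallj h44 q κ r).trans ?_
    have h1 : 2 * (8 * (d + 1) * (d + 4) * (L : ℝ) ^ 2 * αj) ≤ 2 * (8 * ((d : ℝ) + 1) * ((d : ℝ) + 4) * (L : ℝ) ^ 2 * (1 / (1024 * ((d : ℝ) + 1) * ((d : ℝ) + 4) * (L : ℝ) ^ 2))) := by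
      exact mul_le_mul_of_nonneg_left (mul_le_mul_of_nonneg_left hαjle (by positivity)) (by norm_num)
    have h2 : 2 * (8 * ((d : ℝ) + 1) * ((d : ℝ) + 4) * (L : ℝ) ^ 2 * (1 / (1024 * ((d : ℝ) + 1) * ((d : ℝ) + 4) * (L : ℝ) ^ 2))) = 1 / 64 := by
      field_simp; ring
    linarith
  -- the product-field correction
  set δ : ℝ := 130 * (d : ℝ) * ((L : ℝ) ^ j * b) with hδ
  have hδ0 : 0 ≤ δ := by positivity
  have htu : ∀ x κ, tildIter L U₀ (expCfg B) j x κ ∈ unitaryUnits 𝔸 :=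
    tildIter_mem_unitaryUnits_of_mem hL hU₀ hα hα3 hα4 h52 hj.le hWu hvu
  have hV₁ : ∀ x κ, ‖((tildIter L U₀ (expCfg B) j x κ : 𝔸ˣ) : 𝔸) - 1‖ ≤ δ ∧ ‖(((tildIter L U₀ (expCfg B) j x κ)⁻¹ : 𝔸ˣ) : 𝔸) - 1‖ ≤ δ := by
    intro x κ
    have h1 := norm_tildIter_sub_one_le_of_mem hd hL hU₀ hα hα3 hα4 h52 hb hB hsmall hc₃ hsm2 hj.le hWu hvu x κ
    exact ⟨h1, (norm_inv_sub_one_le (unitaryUnits_le_U1 (htu x κ))).trans h1⟩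
  have hprod := norm_Wcx_mul_sub_one_le L (V₀ := avgIter L U₀ j) (V₁ := tildIter L U₀ (expCfg B) j) hV hδ0 hV₁ q κ (boxVec L r)
  rw [tildIter_mul] at hprod
  -- the loop-length arithmetic
  set m : ℕ := 2 * l1 (boxVec L r) + L + L with hm
  have hmle : (m : ℝ) ≤ 2 * (d : ℝ) * L + 2 * L := by
    have := l1_boxVec_le L r
    have : (m : ℝ) = 2 * (l1 (boxVec L r) : ℝ) + L + L := by rw [hm]; push_cast; ring
    rw [this]
    have : ((l1 (boxVec L r) : ℕ) : ℝ) ≤ (d : ℝ) * L := by exact_mod_cast l1_boxVec_le L r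
    linarith
  have hMδ : (m : ℝ) * δ ≤ 1 / 15 := by
    have h1 : (m : ℝ) * δ ≤ (2 * (d : ℝ) * L + 2 * L) * δ := mul_le_mul_of_nonneg_right hmle hδ0
    have h2 : (2 * (d : ℝ) * L + 2 * L) * δ = 260 * (d : ℝ) * ((d : ℝ) + 1) * ((L : ℝ) ^ (j + 1) * b) := by rw [hδ, pow_succ]; ring
    linarith [h260 j hj]
  have hMδ0 : 0 ≤ (m : ℝ) * δ := by positivity
  have hpow : (1 + δ) ^ m - 1 ≤ 2 * ((m : ℝ) * δ) := by
    have h1 : (1 + δ) ^ m ≤ Real.exp δ ^ m := pow_le_pow_left₀ (by linarith) (by linarith [Real.add_one_le_exp δ]) m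
    rw [← Real.exp_nat_mul] at h1
    have h2 := Real.abs_exp_sub_one_le (x := (m : ℝ) * δ) (by rw [abs_of_nonneg hMδ0]; linarith)
    rw [abs_of_nonneg hMδ0] at h2
    have h3 := le_abs_self (Real.exp ((m : ℝ) * δ) - 1)
    linarith
  linarith

end Tower

end Summit.QuantumFields.YangMills.Theorems.Prop7CombTowerLevelUnitarity

end
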